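import Summits.HodgeConjecture.HodgeConjecture.Theorems.MilnorKExponentialSymbolLiftRSymbolPullbackMorphism
import HarnessLib

/-!
# Model transport for symbol cocycles: from a SCALAR-PINNED model to every integration-scaled model

Theorems file of route `MilnorKExponential` of the Hodge summit, crux `SymbolLiftR`
(stmt-HodgeConjecture-18702), line `lefschetz-fold`, kernel `stub_primitiveLiftExists`.

The standing disprover's §7.6 (`Cruxes/SymbolLiftR/Disproof.lean` v4) isolates the exact surplus of
the kernel S5∃ over the crux: `ModelTransport` — a symbol cocycle on SOME symbol-normalised Hodge
model `A'` of `X` should give one on EVERY integration-scaled model `B` of `X` — and names its two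
missing ingredients: (a) transport of covers / cocycles / zig-zags along the biholomorphism
`A'^an ≅ B^an`, (b) the pinning of the comparison scalar of a normalised model to
`ℚˣ · (2πi)^{-(q+1)}` (Chern rationality of the `dlog`-power cocycle of a line bundle). Ingredient
(a) is now in the tree (`…SymbolPullback`, `…TransgressionPullback`, `…SymbolPullbackMorphism`); this
file proves `ModelTransport` MODULO (b), i.e. from any model whose comparison in degree `2q + 2` is
a non-zero RATIONAL multiple of `(2πi)^{-(q+1)} •` (integration `⊗ ℂ`):

* `HodgeModel.hasSymbolCocycle_of_rat_multiple` — a Milnor cocycle with a transgression whose class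
  is a non-zero RATIONAL multiple `r • B^* c` already gives `B.HasSymbolCocycle q c` (scale the cocycle
  by the denominator of `r`);
* `HodgeModel.HasSymbolCocycle.transport_of_pinned` — **if `A'.deRham = r (2πi)^{-(q+1)} • (∫ ⊗ ℂ)` in
  degree `2q + 2` with `r ∈ ℚˣ`, then `A'.HasSymbolCocycle q c → B.HasSymbolCocycle q c` for every
  integration-scaled model `B` of the same smooth projective `X`** (transport along
  `(𝟙 X)^an : B^an → A'^an`, cross-model naturality of integration, then the rational rescaling).

So the surplus of S5∃ over the crux is exactly (b): "every symbol-normalised model is pinned"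
(`A'.IsSymbolNormalized q → ∃ r ∈ ℚˣ, A'.deRham|_{H^{2q+2}} = r (2πi)^{-(q+1)} • ∫ ⊗ ℂ`), a statement
about ONE line bundle per model (rigidity `NaturalDeRhamComparisonRigidity_holds` supplies the scalar,
the normalisation clause and Chern rationality would pin it).

References: C. Voisin, *Hodge Theory I* (2002), Thm. 7.10, §7.3.2; J. M. Lee (2013), Thm. 18.14;
H. Esnault, E. Viehweg (1988), §7.
-/

noncomputable section

-- The mandated namespace repeats `HodgeConjecture` (single-conjunct summit).
set_option linter.dupNamespace false
-- see "Implementation notes" in `…SingularHomology.SingularChainsConcrete`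
set_option backward.isDefEq.respectTransparency false

open scoped Manifold Topology ContDiff
open Set Function Filter

namespace Summit.HodgeConjecture.HodgeConjecture.Theorems.SymbolLiftR

open Literature.Geometry.Kaehler Literature.NumberTheory.Transcendental
open Literature.AlgebraicGeometry Literature.AlgebraicGeometry.HodgeTheory
open Literature.AlgebraicTopology.SingularHomology (singularCohomology)
open CategoryTheory

variable {n : ℕ} {X : Motives.SchemeOver ℂ}

/-- **A cocycle whose transgressed class is a non-zero RATIONAL multiple of `B^* c` is a symbol
cocycle for `c`.** Given a finite open cover, a Milnor symbol cocycle `σ` of weight `q + 1`, a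
transgression `θ` of its symbol forms and `r ∈ ℚˣ` with `B.deRham [θ] = r • B^* c`, scaling `σ` and
`θ` by the denominator `d` of `r` gives `B.deRham [d θ] = num(r) • B^* c` with `num(r) ∈ ℤ ∖ {0}`,
i.e. `B.HasSymbolCocycle q c`. [folklore] -/
theorem _root_.Literature.AlgebraicGeometry.HodgeTheory.HodgeModel.hasSymbolCocycle_of_rat_multiple
    (B : HodgeModel n X) {q : ℕ} {c : complexBetti X (2 * (q + 1))}
    {ι : Type} [Fintype ι] {U : ι → Set B.carrier} (hU : ∀ i, IsOpen (U i)) (hcov : ∀ x, ∃ i, x ∈ U i)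
    {σ : (Fin (q + 2) → ι) → ((Fin (q + 1) → (B.carrier → ℂ)) →₀ ℤ)}
    (hσ : IsMilnorSymbolCocycle B.model U σ) (θ : cclosedSmoothForms B.model B.carrier (2 * q + 1 + 1))
    (hT : IsTransgression hU q (fun J ↦ symbolForm B.model (q + 1) (σ J)) θ) {r : ℚ} (hr : r ≠ 0)
    (hclass : B.deRham B.carrier (2 * q + 1 + 1)
        (complexDeRhamCohomology.mk B.model B.carrier (2 * q + 1 + 1) θ) =
      (r : ℂ) • B.pullback (2 * q + 1 + 1) c) :
    B.HasSymbolCocycle q c := by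
  set k : ℤ := (r.den : ℤ) with hk
  have hσk : IsMilnorSymbolCocycle B.model U (k • σ) :=
    (milnorSymbolCocycles B.model U (q + 1) (q + 1)).zsmul_mem hσ k
  refine ⟨ι, inferInstance, U, hU, hcov, k • σ, hσk, (k : ℂ) • θ, r.num, Rat.num_ne_zero.2 hr, ?_, ?_⟩
  · have hks : ∀ s : (Fin (q + 1) → (B.carrier → ℂ)) →₀ ℤ,
        symbolForm B.model (q + 1) (k • s) = k • symbolForm B.model (q + 1) s :=
      fun s ↦ map_zsmul (symbolFormHom B.model (q + 1)) k s
    have e : (fun J ↦ symbolForm B.model (q + 1) ((k • σ) J)) =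
        (k : ℝ) • fun J ↦ symbolForm B.model (q + 1) (σ J) := by
      funext J
      simp only [Pi.smul_apply, hks, Int.cast_smul_eq_zsmul]
    have e' : (((k : ℂ) • θ : cclosedSmoothForms B.model B.carrier (2 * q + 1 + 1)) :
          MForm 𝓘(ℝ, B.model) B.carrier ℂ (2 * q + 1 + 1)) =
        (k : ℝ) • (θ : MForm 𝓘(ℝ, B.model) B.carrier ℂ (2 * q + 1 + 1)) := by
      rw [Submodule.coe_smul, Int.cast_smul_eq_zsmul, Int.cast_smul_eq_zsmul]
    rw [e, e']
    exact hT.smul (k : ℝ)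
  · rw [map_smul, map_smul, hclass, smul_smul]
    congr 1
    rw [hk]
    exact_mod_cast (mul_comm (r.den : ℚ) r).trans (Rat.mul_den_eq_num r)

/-- **Model transport from a scalar-pinned model to an integration-scaled one.** Let `X` be smooth
projective, `A'` a Hodge model whose comparison in degree `2q + 2` is `r (2πi)^{-(q+1)} •`
(integration `⊗ ℂ`) for a non-zero RATIONAL `r` (the pinning that the normalisation clause of a
symbol-normalised model is expected to provide through Chern rationality), and `B` an
integration-scaled Hodge model. Then `A'.HasSymbolCocycle q c → B.HasSymbolCocycle q c`: transport
the cover, the cocycle and the zig-zag along the holomorphic `(𝟙 X)^an : B^an → A'^an`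
(`IsMilnorSymbolCocycle.comp`, `IsTransgression.pullback`, `symbolForm_mapDomain_apply`), compare
the classes through the cross-model naturality of integration
(`complexify_integration_map_of_contMDiff`) — the transported class is `(r⁻¹ m) • B^* c` — and rescale
by the denominator (`hasSymbolCocycle_of_rat_multiple`). [cite: VoisinHodgeI2002, §7.3.2] -/
theorem _root_.Literature.AlgebraicGeometry.HodgeTheory.HodgeModel.HasSymbolCocycle.transport_of_pinned
    (hX : Motives.IsSmoothProjective n X) (A' B : HodgeModel n X) {q : ℕ} {r : ℚ} (hr : r ≠ 0)
    (hA' : ∀ y : complexDeRhamCohomology A'.model A'.carrier (2 * q + 1 + 1),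
      A'.deRham A'.carrier (2 * q + 1 + 1) y =
        ((r : ℂ) * ((2 * (Real.pi : ℂ) * Complex.I) ^ (q + 1))⁻¹) •
          (integrationDeRhamIsoFamily A'.model).complexify A'.carrier (2 * q + 1 + 1) y)
    (hB : ∀ (k : ℕ) (y : complexDeRhamCohomology B.model B.carrier k),
      B.deRham B.carrier k y = ((2 * (Real.pi : ℂ) * Complex.I) ^ (k / 2))⁻¹ •
        (integrationDeRhamIsoFamily B.model).complexify B.carrier k y)
    {c : complexBetti X (2 * (q + 1))} (h : A'.HasSymbolCocycle q c) : B.HasSymbolCocycle q c := by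
  -- topological instances on the two carriers (compact Hausdorff manifolds)
  haveI : CompactSpace A'.carrier := by
    haveI := compactSpace_complexPoints_of_isSmoothProjective hX
    exact A'.isAnalytification.homeomorph.symm.compactSpace
  haveI : CompactSpace B.carrier := by
    haveI := compactSpace_complexPoints_of_isSmoothProjective hX
    exact B.isAnalytification.homeomorph.symm.compactSpace
  haveI : SecondCountableTopology A'.carrier :=
    ChartedSpace.secondCountable_of_sigmaCompact A'.model A'.carrier
  haveI : SecondCountableTopology B.carrier := ChartedSpace.secondCountable_of_sigmaCompact B.model B.carrier
  obtain ⟨ι, hι, U, hU, hcov, σ, hσ, θ, m, hm, hT, hdR⟩ := h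
  set φ : B.carrier → A'.carrier := HodgeModel.anMap A' B (𝟙 X) with hφdef
  have hφc : MDifferentiable 𝓘(ℂ, B.model) 𝓘(ℂ, A'.model) φ :=
    HodgeModel.mdifferentiable_anMap A' B (𝟙 X) hX hX
  have hφ : ContMDiff 𝓘(ℝ, B.model) 𝓘(ℝ, A'.model) ∞ φ := HodgeModel.contMDiff_anMap A' B (𝟙 X) hX hX
  have hU' : ∀ i, IsOpen (φ ⁻¹' U i) := fun i ↦ (hU i).preimage hφ.continuous
  -- the transported cocycle and zig-zag
  have hT' : IsTransgression hU' q
      (fun J ↦ symbolForm B.model (q + 1)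
        (Finsupp.mapDomain (fun (t : Fin (q + 1) → A'.carrier → ℂ) (i : Fin (q + 1)) ↦ t i ∘ φ) (σ J)))
      ((θ : MForm 𝓘(ℝ, A'.model) A'.carrier ℂ (2 * q + 1 + 1)).pullback 𝓘(ℝ, B.model) φ) := by
    refine (hT.pullback hφ).congr_top fun J y hy ↦ ?_
    have hy' : φ y ∈ cechSet U J := by rwa [cechSet_preimage] at hy
    exact (symbolForm_mapDomain_apply (isOpen_cechSet hU J) (fun t ht ↦ hσ.good J ht) hφ hy').symm
  -- scalars
  have hs0 : (2 * (Real.pi : ℂ) * Complex.I) ≠ 0 := Complex.two_pi_I_ne_zero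
  have hpow : (2 * (Real.pi : ℂ) * Complex.I) ^ (q + 1) ≠ 0 := pow_ne_zero _ hs0
  have hrc : (r : ℂ) ≠ 0 := by exact_mod_cast hr
  -- the integration class of `θ` on `A'`: `∫[θ] = (r (2πi)^{-(q+1)})⁻¹ m • A'^* c`
  have hint : (integrationDeRhamIsoFamily A'.model).complexify A'.carrier (2 * q + 1 + 1)
        (complexDeRhamCohomology.mk A'.model A'.carrier (2 * q + 1 + 1) θ) =
      (((r : ℂ) * ((2 * (Real.pi : ℂ) * Complex.I) ^ (q + 1))⁻¹)⁻¹ * (m : ℂ)) •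
        A'.pullback (2 * q + 1 + 1) c := by
    have h1 := hA' (complexDeRhamCohomology.mk A'.model A'.carrier (2 * q + 1 + 1) θ)
    rw [hdR] at h1
    have hne : (r : ℂ) * ((2 * (Real.pi : ℂ) * Complex.I) ^ (q + 1))⁻¹ ≠ 0 :=
      mul_ne_zero hrc (inv_ne_zero hpow)
    rw [mul_smul, h1, smul_smul, inv_mul_cancel₀ hne, one_smul]
  -- the class of the transported form on `B`: `(r⁻¹ m) • B^* c`
  have hclass : B.deRham B.carrier (2 * q + 1 + 1)
      (complexDeRhamCohomology.mk B.model B.carrier (2 * q + 1 + 1)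
        ⟨(θ : MForm 𝓘(ℝ, A'.model) A'.carrier ℂ (2 * q + 1 + 1)).pullback 𝓘(ℝ, B.model) φ,
          pullback_mem_cclosedSmoothForms hφ θ.2⟩) =
      (((r⁻¹ * m : ℚ)) : ℂ) • B.pullback (2 * q + 1 + 1) c := by
    rw [hB, ← complexDeRhamCohomology.map_mk hφ θ, complexify_integration_map_of_contMDiff hφ, hint,
      map_smul, HodgeModel.map_anMap_pullback A' B (𝟙 X) (2 * q + 1 + 1) c, smul_smul]
    have hdeg : (2 * q + 1 + 1) / 2 = q + 1 := by omega
    rw [hdeg]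
    have hid : singularCohomology.map ℂ ℂ (Motives.AlgPoints.mapContinuous (L := ℂ) (𝟙 X))
        (2 * q + 1 + 1) c = c := by
      change complexBetti.map (𝟙 X) (2 * q + 1 + 1) c = c
      rw [complexBetti.map_id]
      rfl
    rw [hid]
    congr 1
    push_cast
    field_simp
  exact B.hasSymbolCocycle_of_rat_multiple hU' (fun y ↦ hcov (φ y)) (hσ.comp hφc) _ hT'
    (mul_ne_zero (inv_ne_zero hr) (by exact_mod_cast hm)) hclass

/-- STUB `stub_hasSymbolCocycle_transport_of_pinned` (helper sub-goal registered on
stmt-HodgeConjecture-18702 for the kernel `stub_primitiveLiftExists`: the disprover's `ModelTransport`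
(§7.6, the exact surplus of the stub over the crux) holds from every SCALAR-PINNED model — what remains
is only the pinning of symbol-normalised models, Chern rationality of one line cocycle):
`HodgeModel.HasSymbolCocycle.transport_of_pinned`, stated closed. [cite: VoisinHodgeI2002, §7.3.2] -/
theorem stub_hasSymbolCocycle_transport_of_pinned : ∀ {n : ℕ} {X : Literature.AlgebraicGeometry.Motives.SchemeOver ℂ}, Literature.AlgebraicGeometry.Motives.IsSmoothProjective n X → ∀ (A' B : Literature.AlgebraicGeometry.HodgeTheory.HodgeModel n X) {q : ℕ} {r : ℚ}, r ≠ 0 → (∀ y : complexDeRhamCohomology A'.model A'.carrier (2 * q + 1 + 1), A'.deRham A'.carrier (2 * q + 1 + 1) y = ((r : ℂ) * ((2 * (Real.pi : ℂ) * Complex.I) ^ (q + 1))⁻¹) • (integrationDeRhamIsoFamily A'.model).complexify A'.carrier (2 * q + 1 + 1) y) → (∀ (k : ℕ) (y : complexDeRhamCohomology B.model B.carrier k), B.deRham B.carrier k y = ((2 * (Real.pi : ℂ) * Complex.I) ^ (k / 2))⁻¹ • (integrationDeRhamIsoFamily B.model).complexify B.carrier k y) → ∀ {c : Literature.AlgebraicGeometry.HodgeTheory.complexBetti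 X (2 * (q + 1))}, A'.HasSymbolCocycle q c → B.HasSymbolCocycle q c :=
  fun hX A' B _ _ hr hA' hB _ h ↦ h.transport_of_pinned hX A' B hr hA' hB

end Summit.HodgeConjecture.HodgeConjecture.Theorems.SymbolLiftR

end
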